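import Summits.QuantumFields.YangMills.Theorems.UnitScaleGibbsLinProxyFluxIdentification
import Literature.MathematicalPhysics.QuantumFieldTheory.Balaban1983to89.T4AxialGaugeSmallField
import HarnessLib

/-!
# `UnitScaleGibbsCollarPairingSecondMoment` — A PLAQUETTE WEIGHT PAIRED WITH THE DRESSED CURVATURE IS ITS COBOUNDARY PAIRED WITH THE DRESSED BONDS,
# UP TO `44η²·‖σ‖₁`; ITS SQUARE IS CONTROLLED BY THE WEIGHTED CAUCHY–SCHWARZ SUM OF DRESSED-BOND SECOND MOMENTS — NO CORRELATION INPUT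
# (the (COLLAR-CS) row of the re-line of LINE 28 «GrossTransfer», crux `UnitScaleTilt.HistoryTailL` stmt-QuantumFields-19936 ∕ `MeanDeviationL` 23083)

Cell `ym3-torus` (YM ladder rung R3 = continuum SU(2) Yang–Mills on T³ — a RUNG, NOT the Clay problem: not d = 4, not infinite volume, not a mass gap),
width seat `ym-ust-19936-w2` (gen 15), pen of record of `stub_linTest`.  Bus 2026-08-29 (NET-FLUX w5 g16 ∕ (A)(B) px5 g10 ∕ WITNESS w7 g16 ∕ FINDING §2 w8 g10 ∕
accounting v2 w2 g15): every repair of LINE 28's identification leaves ONE non-Schwinger–Dyson term, a weight `σ` (the smoothed collar ∕ the time-spread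
column charge) of `ℓ¹`-mass `≍ (L²)^j` paired with the dressed curvature, whose second moment must be PERIMETER-size.  THIS FILE is the deterministic half
of that row: §1 regroups `Σ_p σ_p·(g(b₀)+g(b₁)−g(b₂)−g(b₃))` (`b_i = slotBond p i`) as `Σ_b (cobd σ)_b·g(b)` with the explicit coboundary
`(cobd σ)_b = Σ_p σ_p·([b₀=b]+[b₁=b]−[b₂=b]−[b₃=b])` (no `def`: spelled out); §2 ★★ `abs_sum_weight_flux_le`: with px5 g10's ✓`abs_re_trace_plaq_sub_curl_le`
(`|Re tr τ(V(∂p)−1) − curl g| ≤ 44η²` when the four slots are `η`-close to `1`, `τ` skew, `‖τ‖ ≤ 2`) and `|Re tr τ(V_b − 1)| ≤ 4‖V_b − 1‖`: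
`|Σ_p σ_p·Re tr(τ(V(∂p) − 1))| ≤ 4·Σ_b |(cobd σ)_b|·‖V_b − 1‖ + 44η²·Σ_p|σ_p|`; §3 ★★ `sq_sum_weight_flux_le`: squaring with the WEIGHTED Cauchy–Schwarz
`(Σ_b a_b x_b)² ≤ (Σ_b a_b)·(Σ_b a_b x_b²)`: `(Σ_p σ_p Re tr τ(V(∂p)−1))² ≤ 32·(Σ_b|cobd σ|_b)·Σ_b |cobd σ|_b·‖V_b − 1‖² + 3872·η⁴·(Σ_p|σ_p|)²` — the
SMOOTHING GAIN lives in `Σ_b|(cobd σ)_b| ≍ ‖σ‖₁∕R` for a weight smooth at scale `R`, and the bond factors `‖V_b − 1‖²` are what the RP thin-rectangle row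
(px5 (THIN-RECT)) integrates to `≲ (comb length)·ε₁`; §4 ★★★ `sq_sum_weight_flux_dressed_le_of_plaqSmallOn_box`: the same ON THE BOX EVENT for the axial-gauge
representative `V = U^{axialGauge U lo hi}` (slots of box plaquettes are box bonds, within `η = (d−1)nθ` of `1` by lit ✓`dist1_gaugeAct_axialGauge_le_uniform`).
Integration against `gibbsK` is the knitter's (✓w8 `UnitScaleGibbsDressedEventSplit.integral_le_of_onEvent_bound`).

HONEST FRAMING.  Finite sums and Cauchy–Schwarz over landed letters; `--supports` helper; proves no stub, crux, rung or summit statement; `stub_linTest`,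
«ShallowFluxSecondMomentL», (Q), K1, `MeanDeviationL`, `HistoryTailL` are NOT proved; the Yang–Mills mass gap is NOT proved.

References: [GrossCMP1983] L. Gross, CMP 92 (1983) 137–162, proof of Thm 2.2 (pairing a test form with the curvature); [Balaban1985Averaging] T. Bałaban,
CMP 98 (1985) 17–51, (19)–(20) p. 21 (bond and plaquette smallness in a gauge).
-/

noncomputable section

set_option autoImplicit false

open scoped BigOperators Matrix Matrix.Norms.L2Operator

namespace Summit.QuantumFields.YangMills.Theorems.UnitScaleGibbsCollarPairingSecondMoment

open Literature.MathematicalPhysics.QuantumFieldTheory.Balaban1983to89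
open Literature.MathematicalPhysics.QuantumFieldTheory.Balaban1983to89.T4AxialGaugeSmallField (castSite castSite_add_e boxPlaqs boxBonds axialGauge
  dist1_gaugeAct_axialGauge_le_of_mem_boxBonds)
open Literature.MathematicalPhysics.QuantumFieldTheory.Balaban1983to89.B7Prop1Explicit (e e_apply)
open Literature.MathematicalPhysics.QuantumFieldTheory.Balaban1983to89.B8Lemma1NonAbelian (e_nonneg)
open Summit.QuantumFields.YangMills.Theorems.UnitScaleGibbsActionDerivativeSlotCalculus (slotBond)
open Summit.QuantumFields.YangMills.Theorems.UnitScaleGibbsLinProxySU2Letters (abs_re_trace_le_two_mul_norm)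
open Summit.QuantumFields.YangMills.Theorems.UnitScaleGibbsLinProxyFluxIdentification (abs_re_trace_plaq_sub_curl_le)

variable {P : Params} {j : ℕ} [DecidableEq (PBond P j)]

/-! ## §1 Regrouping a weighted curl by bonds -/

/-- **SUMMATION BY PARTS ON THE PLAQUETTE–BOND INCIDENCE**: `Σ_p σ_p·(g(b₀)+g(b₁)−g(b₂)−g(b₃)) = Σ_b (cobd σ)_b·g(b)`,
`(cobd σ)_b = Σ_p σ_p·([slotBond p 0 = b] + [slotBond p 1 = b] − [slotBond p 2 = b] − [slotBond p 3 = b])`. [folklore] -/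
theorem sum_weight_curl_eq_sum_cobd (σ : Plaq P j → ℝ) (g : PBond P j → ℝ) :
    ∑ p : Plaq P j, σ p * (g (slotBond p 0) + g (slotBond p 1) - g (slotBond p 2) - g (slotBond p 3)) =
      ∑ b : PBond P j, (∑ p : Plaq P j, σ p * ((if slotBond p 0 = b then 1 else 0) + (if slotBond p 1 = b then 1 else 0) -
        (if slotBond p 2 = b then 1 else 0) - (if slotBond p 3 = b then 1 else 0))) * g b := by
  classical
  have hfib : ∀ (p : Plaq P j) (i : Fin 4), ∑ b : PBond P j, (if slotBond p i = b then (1 : ℝ) else 0) * g b = g (slotBond p i) := by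
    intro p i
    simp [Finset.sum_ite_eq, ite_mul]
  symm
  calc ∑ b : PBond P j, (∑ p : Plaq P j, σ p * ((if slotBond p 0 = b then 1 else 0) + (if slotBond p 1 = b then 1 else 0) -
          (if slotBond p 2 = b then 1 else 0) - (if slotBond p 3 = b then 1 else 0))) * g b
      = ∑ b : PBond P j, ∑ p : Plaq P j, σ p * (((if slotBond p 0 = b then 1 else 0) + (if slotBond p 1 = b then 1 else 0) -
          (if slotBond p 2 = b then 1 else 0) - (if slotBond p 3 = b then 1 else 0)) * g b) := by
        refine Finset.sum_congr rfl fun b _ => ?_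
        rw [Finset.sum_mul]
        refine Finset.sum_congr rfl fun p _ => ?_
        ring
    _ = ∑ p : Plaq P j, ∑ b : PBond P j, σ p * (((if slotBond p 0 = b then 1 else 0) + (if slotBond p 1 = b then 1 else 0) -
          (if slotBond p 2 = b then 1 else 0) - (if slotBond p 3 = b then 1 else 0)) * g b) := Finset.sum_comm
    _ = ∑ p : Plaq P j, σ p * (g (slotBond p 0) + g (slotBond p 1) - g (slotBond p 2) - g (slotBond p 3)) := by
        refine Finset.sum_congr rfl fun p _ => ?_
        rw [← Finset.mul_sum]
        congr 1
        simp only [add_mul, sub_mul, Finset.sum_add_distrib, Finset.sum_sub_distrib, hfib]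

/-! ## §2 The pointwise bound: weight × curvature ≤ coboundary × bonds + second order -/

section Pointwise

/-- ★★ **`|Σ_p σ_p·Re tr(τ(V(∂p) − 1))| ≤ 4·Σ_b |(cobd σ)_b|·‖V_b − 1‖ + 44η²·Σ_p |σ_p|`** for `τ` skew-Hermitian with `‖τ‖ ≤ 2`, `0 ≤ η ≤ 1`, and
every slot of every plaquette in the support of `σ` within `η` of `1`. [cite: GrossCMP1983, Thm 2.2 (proof)] -/
theorem abs_sum_weight_flux_le (V : GaugeField P j (Matrix.specialUnitaryGroup (Fin 2) ℂ)) (σ : Plaq P j → ℝ)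
    (τ : Matrix (Fin 2) (Fin 2) ℂ) (hτ : τᴴ = -τ) (hτ2 : ‖τ‖ ≤ 2) {η : ℝ} (hη0 : 0 ≤ η) (hη1 : η ≤ 1)
    (hV : ∀ p, σ p ≠ 0 → ∀ i : Fin 4, ‖(V (slotBond p i) : Matrix (Fin 2) (Fin 2) ℂ) - 1‖ ≤ η) :
    |∑ p : Plaq P j, σ p * (τ * (((GaugeField.plaqHol V p : Matrix.specialUnitaryGroup (Fin 2) ℂ) : Matrix (Fin 2) (Fin 2) ℂ) - 1)).trace.re| ≤
      4 * ∑ b : PBond P j, |∑ p : Plaq P j, σ p * ((if slotBond p 0 = b then 1 else 0) + (if slotBond p 1 = b then 1 else 0) -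
          (if slotBond p 2 = b then 1 else 0) - (if slotBond p 3 = b then 1 else 0))| * ‖(V b : Matrix (Fin 2) (Fin 2) ℂ) - 1‖ +
        44 * η ^ 2 * ∑ p : Plaq P j, |σ p| := by
  classical
  set g : PBond P j → ℝ := fun b => (τ * ((V b : Matrix (Fin 2) (Fin 2) ℂ) - 1)).trace.re with hg
  set F : Plaq P j → ℝ := fun p =>
    (τ * (((GaugeField.plaqHol V p : Matrix.specialUnitaryGroup (Fin 2) ℂ) : Matrix (Fin 2) (Fin 2) ℂ) - 1)).trace.re with hF
  -- per-plaquette linearisation on the support of `σ`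
  have hplaq : ∀ p, |σ p * F p - σ p * (g (slotBond p 0) + g (slotBond p 1) - g (slotBond p 2) - g (slotBond p 3))| ≤
      |σ p| * (44 * η ^ 2) := by
    intro p
    by_cases hp : σ p = 0
    · simp [hp]
    · rw [← mul_sub, abs_mul]
      exact mul_le_mul_of_nonneg_left (abs_re_trace_plaq_sub_curl_le V p τ hτ hτ2 hη0 hη1 (hV p hp)) (abs_nonneg _)
  -- the bond factors: `|g b| ≤ 4‖V_b − 1‖`
  have hgb : ∀ b, |g b| ≤ 4 * ‖(V b : Matrix (Fin 2) (Fin 2) ℂ) - 1‖ := by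
    intro b
    have h1 := abs_re_trace_le_two_mul_norm (τ * ((V b : Matrix (Fin 2) (Fin 2) ℂ) - 1))
    have h2 : ‖τ * ((V b : Matrix (Fin 2) (Fin 2) ℂ) - 1)‖ ≤ 2 * ‖(V b : Matrix (Fin 2) (Fin 2) ℂ) - 1‖ :=
      (Matrix.l2_opNorm_mul _ _).trans (mul_le_mul_of_nonneg_right hτ2 (norm_nonneg _))
    show |(τ * ((V b : Matrix (Fin 2) (Fin 2) ℂ) - 1)).trace.re| ≤ 4 * ‖(V b : Matrix (Fin 2) (Fin 2) ℂ) - 1‖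
    linarith
  -- split
  have hsplit : ∑ p, σ p * F p = ∑ p, σ p * (g (slotBond p 0) + g (slotBond p 1) - g (slotBond p 2) - g (slotBond p 3)) +
      ∑ p, (σ p * F p - σ p * (g (slotBond p 0) + g (slotBond p 1) - g (slotBond p 2) - g (slotBond p 3))) := by
    rw [← Finset.sum_add_distrib]
    refine Finset.sum_congr rfl fun p _ => ?_
    ring
  rw [hsplit, sum_weight_curl_eq_sum_cobd σ g]
  refine (abs_add_le _ _).trans (add_le_add ?_ ?_)
  · refine (Finset.abs_sum_le_sum_abs _ _).trans ?_
    rw [Finset.mul_sum]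
    refine Finset.sum_le_sum fun b _ => ?_
    rw [abs_mul]
    calc _ ≤ _ := mul_le_mul_of_nonneg_left (hgb b) (abs_nonneg _)
      _ = _ := by ring
  · refine (Finset.abs_sum_le_sum_abs _ _).trans ?_
    rw [Finset.mul_sum]
    refine Finset.sum_le_sum fun p _ => ?_
    rw [mul_comm (44 * η ^ 2)]
    exact hplaq p

/-- ★★ **THE SQUARE, BY WEIGHTED CAUCHY–SCHWARZ**: under the hypotheses of `abs_sum_weight_flux_le`,
`(Σ_p σ_p Re tr τ(V(∂p)−1))² ≤ 32·(Σ_b |cobd σ|_b)·Σ_b |cobd σ|_b·‖V_b − 1‖² + 3872·η⁴·(Σ_p|σ_p|)²`. [cite: GrossCMP1983, Thm 2.2 (proof)] -/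
theorem sq_sum_weight_flux_le (V : GaugeField P j (Matrix.specialUnitaryGroup (Fin 2) ℂ)) (σ : Plaq P j → ℝ)
    (τ : Matrix (Fin 2) (Fin 2) ℂ) (hτ : τᴴ = -τ) (hτ2 : ‖τ‖ ≤ 2) {η : ℝ} (hη0 : 0 ≤ η) (hη1 : η ≤ 1)
    (hV : ∀ p, σ p ≠ 0 → ∀ i : Fin 4, ‖(V (slotBond p i) : Matrix (Fin 2) (Fin 2) ℂ) - 1‖ ≤ η) :
    (∑ p : Plaq P j, σ p * (τ * (((GaugeField.plaqHol V p : Matrix.specialUnitaryGroup (Fin 2) ℂ) : Matrix (Fin 2) (Fin 2) ℂ) - 1)).trace.re) ^ 2 ≤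
      32 * (∑ b : PBond P j, |∑ p : Plaq P j, σ p * ((if slotBond p 0 = b then 1 else 0) + (if slotBond p 1 = b then 1 else 0) -
          (if slotBond p 2 = b then 1 else 0) - (if slotBond p 3 = b then 1 else 0))|) *
        ∑ b : PBond P j, |∑ p : Plaq P j, σ p * ((if slotBond p 0 = b then 1 else 0) + (if slotBond p 1 = b then 1 else 0) -
          (if slotBond p 2 = b then 1 else 0) - (if slotBond p 3 = b then 1 else 0))| * ‖(V b : Matrix (Fin 2) (Fin 2) ℂ) - 1‖ ^ 2 +
        3872 * η ^ 4 * (∑ p : Plaq P j, |σ p|) ^ 2 := by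
  classical
  set a : PBond P j → ℝ := fun b => |∑ p : Plaq P j, σ p * ((if slotBond p 0 = b then 1 else 0) + (if slotBond p 1 = b then 1 else 0) -
    (if slotBond p 2 = b then 1 else 0) - (if slotBond p 3 = b then 1 else 0))| with ha
  set x : PBond P j → ℝ := fun b => ‖(V b : Matrix (Fin 2) (Fin 2) ℂ) - 1‖ with hx
  have hmain := abs_sum_weight_flux_le V σ τ hτ hτ2 hη0 hη1 hV
  have hA : 0 ≤ 4 * ∑ b, a b * x b := by positivity
  have hB : 0 ≤ 44 * η ^ 2 * ∑ p : Plaq P j, |σ p| := by positivity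
  -- weighted Cauchy–Schwarz `(Σ a x)² ≤ (Σ a)(Σ a x²)` (≡ lit `GuthMaynardAffine.sq_sum_mul_le`; inlined to keep the import closure physical)
  have hCS : (∑ b, a b * x b) ^ 2 ≤ (∑ b, a b) * ∑ b, a b * x b ^ 2 := by
    have h := Finset.sum_mul_sq_le_sq_mul_sq Finset.univ (fun b => Real.sqrt (a b)) (fun b => Real.sqrt (a b) * x b)
    have ha' : ∀ b, 0 ≤ a b := fun b => abs_nonneg _
    have e1 : ∀ b ∈ (Finset.univ : Finset (PBond P j)), Real.sqrt (a b) * (Real.sqrt (a b) * x b) = a b * x b := fun b _ => by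
      rw [← mul_assoc, Real.mul_self_sqrt (ha' b)]
    have e2 : ∀ b ∈ (Finset.univ : Finset (PBond P j)), Real.sqrt (a b) ^ 2 = a b := fun b _ => Real.sq_sqrt (ha' b)
    have e3 : ∀ b ∈ (Finset.univ : Finset (PBond P j)), (Real.sqrt (a b) * x b) ^ 2 = a b * x b ^ 2 := fun b _ => by
      rw [mul_pow, Real.sq_sqrt (ha' b)]
    rw [Finset.sum_congr rfl e1, Finset.sum_congr rfl e2, Finset.sum_congr rfl e3] at h
    exact h
  have h1 : (∑ p : Plaq P j, σ p * (τ * (((GaugeField.plaqHol V p : Matrix.specialUnitaryGroup (Fin 2) ℂ) : Matrix (Fin 2) (Fin 2) ℂ) - 1)).trace.re) ^ 2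
      ≤ (4 * ∑ b, a b * x b + 44 * η ^ 2 * ∑ p : Plaq P j, |σ p|) ^ 2 := by
    have := abs_le.mp (hmain.trans le_rfl)
    nlinarith [this.1, this.2]
  have h2 : (4 * ∑ b, a b * x b + 44 * η ^ 2 * ∑ p : Plaq P j, |σ p|) ^ 2 ≤
      2 * (4 * ∑ b, a b * x b) ^ 2 + 2 * (44 * η ^ 2 * ∑ p : Plaq P j, |σ p|) ^ 2 := by
    nlinarith [sq_nonneg (4 * ∑ b, a b * x b - 44 * η ^ 2 * ∑ p : Plaq P j, |σ p|)]
  calc _ ≤ _ := h1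
    _ ≤ _ := h2
    _ ≤ 32 * ((∑ b, a b) * ∑ b, a b * x b ^ 2) + 3872 * η ^ 4 * (∑ p : Plaq P j, |σ p|) ^ 2 := by nlinarith [hCS]
    _ = _ := by ring

end Pointwise

/-! ## §3 On the box event, for the axial-gauge representative -/

section BoxEvent

omit [DecidableEq (PBond P j)] in
/-- The four slot bonds of a box plaquette are box bonds. [folklore] -/
theorem slotBond_mem_boxBonds {lo hi : Fin P.d → ℤ} {p : Plaq P j} (hp : p ∈ (boxPlaqs lo hi : Set (Plaq P j))) (i : Fin 4) :
    slotBond p i ∈ (boxBonds lo hi : Set (PBond P j)) := by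
  obtain ⟨z, hlo, hhi, hsrc⟩ := hp
  have heμ : ∀ κ, (0 : ℤ) ≤ e p.μ κ := fun κ => by have := e_nonneg p.μ κ; simpa using this
  have heν : ∀ κ, (0 : ℤ) ≤ e p.ν κ := fun κ => by have := e_nonneg p.ν κ; simpa using this
  have hμ : z + e p.μ ≤ hi := fun κ => by
    have h := hhi κ; have h' := heν κ
    simp only [Pi.add_apply] at h ⊢; linarith
  have hν : z + e p.ν ≤ hi := fun κ => by
    have h := hhi κ; have h' := heμ κ
    simp only [Pi.add_apply] at h ⊢; linarith
  have hloμ : lo ≤ z + e p.μ := fun κ => by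
    have h := hlo κ; have h' := heμ κ
    simp only [Pi.add_apply]; linarith
  have hloν : lo ≤ z + e p.ν := fun κ => by
    have h := hlo κ; have h' := heν κ
    simp only [Pi.add_apply]; linarith
  have hhi' : z + e p.ν + e p.μ ≤ hi := by rwa [add_right_comm]
  have e0 : slotBond p 0 = ⟨p.src, p.μ⟩ := rfl
  have e1 : slotBond p 1 = ⟨p.src.shift p.μ, p.ν⟩ := rfl
  have e2 : slotBond p 2 = ⟨p.src.shift p.ν, p.μ⟩ := rfl
  have e3 : slotBond p 3 = ⟨p.src, p.ν⟩ := rfl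
  fin_cases i
  · show slotBond p 0 ∈ _
    rw [e0]; exact ⟨z, hlo, hμ, hsrc⟩
  · show slotBond p 1 ∈ _
    rw [e1]; exact ⟨z + e p.μ, hloμ, hhi, by rw [hsrc, castSite_add_e]⟩
  · show slotBond p 2 ∈ _
    rw [e2]; exact ⟨z + e p.ν, hloν, hhi', by rw [hsrc, castSite_add_e]⟩
  · show slotBond p 3 ∈ _
    rw [e3]; exact ⟨z, hlo, hν, hsrc⟩

variable {G : Type*}

/-- ★★★ **THE COLLAR ROW ON THE BOX EVENT.**  Let `[lo, hi]` be a non-wrapping box (`hi ≤ lo + n`, `n < sitesPerDir`), `U` with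
`PlaqSmallOn (boxPlaqs lo hi) θ U`, `0 ≤ θ`, `η := (d−1)·n·θ ≤ 1`, `V = U^{axialGauge U lo hi}`, `σ` a weight supported on box plaquettes, `τ` skew with
`‖τ‖ ≤ 2`.  Then
`(Σ_p σ_p Re tr τ(V(∂p)−1))² ≤ 32·(Σ_b|cobd σ|_b)·Σ_b |cobd σ|_b·‖V_b − 1‖² + 3872·η⁴·(Σ_p|σ_p|)²`
— the bond factors are `dist₁` of DRESSED bonds (conjugated comb ladders: thin Wilson rectangles), to be integrated by the RP thin-rectangle row.
[cite: Balaban1985Averaging, (19)-(20) p.21; GrossCMP1983, Thm 2.2 (proof)] -/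
theorem sq_sum_weight_flux_dressed_le_of_plaqSmallOn_box (U : GaugeField P j (Matrix.specialUnitaryGroup (Fin 2) ℂ))
    {lo hi : Fin P.d → ℤ} {n : ℕ} (hn : ∀ κ, hi κ ≤ lo κ + n) (hnN : n < P.sitesPerDir j) {θ : ℝ} (hθ : 0 ≤ θ)
    (hU : PlaqSmallOn (boxPlaqs lo hi) θ U) (hη1 : ((P.d - 1 : ℕ) : ℝ) * n * θ ≤ 1)
    (σ : Plaq P j → ℝ) (hσ : ∀ p, σ p ≠ 0 → p ∈ (boxPlaqs lo hi : Set (Plaq P j)))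
    (τ : Matrix (Fin 2) (Fin 2) ℂ) (hτ : τᴴ = -τ) (hτ2 : ‖τ‖ ≤ 2) :
    (∑ p : Plaq P j, σ p * (τ * (((GaugeField.plaqHol (GaugeField.gaugeAct (axialGauge U lo hi) U) p :
        Matrix.specialUnitaryGroup (Fin 2) ℂ) : Matrix (Fin 2) (Fin 2) ℂ) - 1)).trace.re) ^ 2 ≤
      32 * (∑ b : PBond P j, |∑ p : Plaq P j, σ p * ((if slotBond p 0 = b then 1 else 0) + (if slotBond p 1 = b then 1 else 0) -
          (if slotBond p 2 = b then 1 else 0) - (if slotBond p 3 = b then 1 else 0))|) *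
        ∑ b : PBond P j, |∑ p : Plaq P j, σ p * ((if slotBond p 0 = b then 1 else 0) + (if slotBond p 1 = b then 1 else 0) -
          (if slotBond p 2 = b then 1 else 0) - (if slotBond p 3 = b then 1 else 0))| *
          ‖((GaugeField.gaugeAct (axialGauge U lo hi) U b : Matrix.specialUnitaryGroup (Fin 2) ℂ) : Matrix (Fin 2) (Fin 2) ℂ) - 1‖ ^ 2 +
        3872 * (((P.d - 1 : ℕ) : ℝ) * n * θ) ^ 4 * (∑ p : Plaq P j, |σ p|) ^ 2 := by
  have hη0 : 0 ≤ ((P.d - 1 : ℕ) : ℝ) * n * θ := by positivity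
  refine sq_sum_weight_flux_le (GaugeField.gaugeAct (axialGauge U lo hi) U) σ τ hτ hτ2 hη0 hη1 fun p hp i => ?_
  have hb := slotBond_mem_boxBonds (hσ p hp) i
  have h := dist1_gaugeAct_axialGauge_le_of_mem_boxBonds U subset_rfl hU hθ hn hnN hb
  -- `dist1 = ‖· − 1‖` in the `SU(2)` model
  exact h

end BoxEvent

end Summit.QuantumFields.YangMills.Theorems.UnitScaleGibbsCollarPairingSecondMoment

end
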